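import Summits.ResolutionOfSingularities.ResolutionOfSingularities.Theses.RuledResidues
import Summits.ResolutionOfSingularities.ResolutionOfSingularities.Theorems.RuledResiduesNonRuledDivisorsStubTransportPlace
import Summits.ResolutionOfSingularities.ResolutionOfSingularities.Theorems.RuledResiduesNonRuledDivisorsStubTransportSingular
import Summits.ResolutionOfSingularities.ResolutionOfSingularities.Theorems.RuledResiduesNonRuledDivisorsStubTransportNonRuled
import Summits.ResolutionOfSingularities.ResolutionOfSingularities.Theorems.RuledResiduesNonRuledDivisorsStubContractingInjective
import Summits.ResolutionOfSingularities.ResolutionOfSingularities.Theorems.RuledResiduesNonRuledDivisorsStubModulusInjective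

/-!
# Crux `NonRuledDivisors` (stmt-ResolutionOfSingularities-18075) — line `automorphism-orbit` (lead's skeleton, v3: five stubs LANDED, one open)

Lead prover `prover-line-stmt-ResolutionOfSingularities-18075-0`, 2026-08-17.  Reshaped from the strategist's registered
skeleton `Lines/automorphism_orbit.lean` (sha 07a4312e…): the L-sized transport stub `stub_transportStep` is split into
three independent registered stubs (`stub_transportPlace`, `stub_transportSingular`, `stub_transportNonRuled`); the hunt
`stub_orbitGerm` and the two engines `stub_contractingInjective`, `stub_modulusInjective` are kept VERBATIM.  Six stubs
(≤ stubs_max = 7).  STATUS v3: stubs 2a/2b/2c/3/4 are LANDED sorry-free under `Theorems/` (p165696, p165626, p165673,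
p165816, p165448) and are invoked here by name; the only `sorry` left is the hunt `stub_orbitGerm`.  The composition `NonRuledDivisors_of : NonRuledDivisors` is kernel-checked from the six stubs BY NAME
(no `sorry` outside `stub_*`).

LEVER (unchanged): the orbit `n ↦ W.comap τⁿ` of ONE non-ruled divisorial place `W` over a singular point `P` of the affine
model `R`, under a ring automorphism `τ` of `K` semilinear over `ι ∈ Aut k` with `τ R ⊆ R`, `τ P ⊆ P`, made injective by
engine (A) (`τ P ⊆ P²`, `P ≠ 0`) or engine (B) (a `τ`-fixed `x` and a scalar `a` of infinite `ι`-orbit with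
`x − a ∈ 𝔪_W`).  Every member of the orbit lies in the crux's witness set:
* `stub_transportPlace`: `k ⊆ W'` (`τ (c·1) = (ι c)·1`), `W' ≃+* W` by restricting `τ` (DVR), the essentially-finite-type
  algebra `B ↦ τ⁻¹B = adjoin k (τ⁻¹ gens)`, `R ≤ W'` (`τR ⊆ R`), domination `P ⊆ 𝔪_{W'}` (`τP ⊆ P ⊆ 𝔪_W`);
* `stub_transportSingular` (τ-free): a valuation ring `W' ⊇ S` with `P ⊆ 𝔪_{W'}` is centred at `Q ⊇ P`, and `S_P` is a
  localisation of `S_Q`, so `S_Q` regular ⇒ `S_P` regular (Serre, Matsumura 19.3 — in tree: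
  `Literature.AlgebraicGeometry.Resolution.isRegularLocalRing_localization_atPrime`); contrapositive;
* `stub_transportNonRuled`: `τ` induces an `ι`-semilinear isomorphism `κ(W') ≃+* κ(W)`; a ruling `(L', t')` of `κ(W')`
  pushes forward to a ruling of `κ(W)` (image of `k` preserved because `ι` is onto).

Disproof.lean honoured (v4, 2026-08-17T11:02Z): no `_false_without_` theorem touches stubs 2a–2c/3/4 beyond the tightness
lemmas p154702 (every hypothesis of stubs 3, 4 kept); engine (A)/(B) empty corners p153573/p154279/p153574 constrain only the
hunt `stub_orbitGerm` (kept verbatim, disjunctive certificate).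
-/

set_option linter.dupNamespace false
set_option linter.unusedVariables false

namespace Summit.ResolutionOfSingularities.ResolutionOfSingularities.Cruxes.NonRuledDivisors.AutomorphismOrbit

open Summit.ResolutionOfSingularities.ResolutionOfSingularities.Theses.RuledResidues

/-! ## Registered stubs -/

/-- STUB 1 — THE HUNT (`orbitGerm`, open; verbatim from the registered skeleton).  There are a prime `p`, a field `k`
of characteristic `p`, a field `K` with an affine model `R` (f.g. `k`-subalgebra, `Frac R = K`), a prime `P` of `R`
with `R_P` NOT regular, a ring automorphism `τ` of `K` semilinear over an automorphism `ι` of `k`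
(`τ (c·1) = (ι c)·1`) with `τ R ⊆ R` and `τ P ⊆ P`, and ONE valuation ring `W` of `K` dominating `P`
(`P ⊆ 𝔪_W`) lying in the crux's witness set, together with an injectivity certificate for the orbit `n ↦ W.comap τⁿ`:
EITHER `τ` contracts `P` (`P ≠ 0`, `τ P ⊆ P²`) OR a transcendental modulus (`τ x = x`, `a ∈ k` with `ιⁿ a ≠ a` for all
`n ≥ 1`, `x − a ∈ 𝔪_W`).  At least crux-sized: with the route's kills it refutes resolution of `Spec R`, so by
Cossart–Piltant any instance has `trdeg_k K ≥ 4`. [difficulty: open-problem] -/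
theorem stub_orbitGerm : ∃ p : ℕ, p.Prime ∧ ∃ (k K : Type) (_ : Field k) (_ : CharP k p) (_ : Field K) (_ : Algebra k K), ∃ R : Subalgebra k K, R.FG ∧ IsFractionRing R K ∧ ∃ (P : Ideal R.toSubring) (_ : P.IsPrime), ¬ IsRegularLocalRing (Localization.AtPrime P) ∧ ∃ (τ : K ≃+* K) (ι : k ≃+* k), (∀ c : k, τ (algebraMap k K c) = algebraMap k K (ι c)) ∧ (∀ r : K, r ∈ R → τ r ∈ R) ∧ (∀ r : R.toSubring, r ∈ P → ∃ r' : R.toSubring, r' ∈ P ∧ (r' : K) = τ (r : K)) ∧ ∃ W : ValuationSubring K, (∀ r : R.toSubring, r ∈ P → (r : K) ∈ W.nonunits) ∧ (∃ hk : (∀ c : k, algebraMap k K c ∈ W), IsDiscreteValuationRing W ∧ (∃ B : Subalgebra k K, B.FG ∧ B.toSubring ≤ W.toSubring ∧ ∀ x : K, x ∈ W → ∃ b s : K, b ∈ B ∧ s ∈ B ∧ s ∉ W.nonunits ∧ x * s = b) ∧ (∃ h : R.toSubring ≤ W.toSubring, ¬ IsRegularLocalRing (Localization.AtPrime (Ideal.comap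 (Subring.inclusion h) (IsLocalRing.maximalIdeal W)))) ∧ ¬ (∃ (L : Subfield (IsLocalRing.ResidueField W)) (t : IsLocalRing.ResidueField W), (∀ c : k, IsLocalRing.residue W ⟨algebraMap k K c, hk c⟩ ∈ L) ∧ (∀ f : Polynomial L, f ≠ 0 → Polynomial.eval₂ L.subtype t f ≠ 0) ∧ (∀ x : IsLocalRing.ResidueField W, ∃ f g : Polynomial L, Polynomial.eval₂ L.subtype t g ≠ 0 ∧ x * Polynomial.eval₂ L.subtype t g = Polynomial.eval₂ L.subtype t f))) ∧ ((P ≠ ⊥ ∧ ∀ r : R.toSubring, r ∈ P → ∃ r' : R.toSubring, r' ∈ P ^ 2 ∧ (r' : K) = τ (r : K)) ∨ (∃ (x : K) (a : k), τ x = x ∧ (∀ n : ℕ, 0 < n → (ι ^ n) a ≠ a) ∧ x - algebraMap k K a ∈ W.nonunits)) := by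
  sorry

/-- STUB 2a — TRANSPORT OF THE PLACE DATA (true; M-sized).  With `τ` semilinear over `ι`, `τ R ⊆ R`, `τ P ⊆ P`,
`W' = W.comap τ = {y | τ y ∈ W}`: `k ⊆ W'` (since `τ (c·1) = (ι c)·1 ∈ W`); `W'` is a DVR (`τ` restricts to a ring
isomorphism `W' ≃+* W`); `W'` is essentially of finite type over `k` (`B ↦ τ⁻¹ B = Algebra.adjoin k (τ.symm '' gens)`,
using `τ⁻¹ (c·1) = (ι⁻¹ c)·1`; the `b/s` presentation pulls back because `y ∈ W'.nonunits ↔ τ y ∈ W.nonunits`);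
`R ≤ W'` (from `τ R ⊆ R ≤ W`); and `P ⊆ 𝔪_{W'}` (from `τ P ⊆ P ⊆ 𝔪_W`). [folklore] -/
theorem stub_transportPlace : ∀ (k K : Type) [Field k] [Field K] [Algebra k K] (R : Subalgebra k K) (P : Ideal R.toSubring) (τ : K ≃+* K) (ι : k ≃+* k), (∀ c : k, τ (algebraMap k K c) = algebraMap k K (ι c)) → (∀ r : K, r ∈ R → τ r ∈ R) → (∀ r : R.toSubring, r ∈ P → ∃ r' : R.toSubring, r' ∈ P ∧ (r' : K) = τ (r : K)) → ∀ (W W' : ValuationSubring K), W' = W.comap (τ : K →+* K) → (∀ c : k, algebraMap k K c ∈ W) → IsDiscreteValuationRing W → (∃ B : Subalgebra k K, B.FG ∧ B.toSubring ≤ W.toSubring ∧ ∀ x : K, x ∈ W → ∃ b s : K, b ∈ B ∧ s ∈ B ∧ s ∉ W.nonunits ∧ x * s = b) → R.toSubring ≤ W.toSubring → (∀ r : R.toSubring, r ∈ P → (r : K) ∈ W.nonunits) → (∀ c : k, algebraMap k K c ∈ W') ∧ IsDiscreteValuationRing W' ∧ (∃ B : Subalgebra k K, B.FG ∧ B.toSubring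 ≤ W'.toSubring ∧ ∀ x : K, x ∈ W' → ∃ b s : K, b ∈ B ∧ s ∈ B ∧ s ∉ W'.nonunits ∧ x * s = b) ∧ R.toSubring ≤ W'.toSubring ∧ (∀ r : R.toSubring, r ∈ P → (r : K) ∈ W'.nonunits) :=
  Summit.ResolutionOfSingularities.ResolutionOfSingularities.Theorems.stub_transportPlace

/-- STUB 2b — DOMINATING A SINGULAR PRIME FORCES A SINGULAR CENTRE (true; S/M-sized; no automorphism involved).
`S ≤ K` a subring, `P` a prime of `S` with `S_P` not regular, `W' ⊇ S` a valuation ring with `P ⊆ 𝔪_{W'}`.  The centre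
`Q = 𝔪_{W'} ∩ S` contains `P`, so `S_P` is the localisation of `S_Q` at `P S_Q`; if `S_Q` were regular then so would be
`S_P` (Serre: `Literature.AlgebraicGeometry.Resolution.isRegularLocalRing_localization_atPrime`, transported along
`IsLocalization.localizationLocalizationAtPrimeIsoLocalization` / `IsRegularLocalRing.of_ringEquiv`).  (If `S_Q` is not
Noetherian it is not regular by definition, so no Noetherian hypothesis is needed.) [cite: Matsumura1987, Thm. 19.3] -/
theorem stub_transportSingular : ∀ (K : Type) [Field K] (S : Subring K) (P : Ideal S) [P.IsPrime], ¬ IsRegularLocalRing (Localization.AtPrime P) → ∀ (W' : ValuationSubring K) (h : S ≤ W'.toSubring), (∀ r : S, r ∈ P → (r : K) ∈ W'.nonunits) → ¬ IsRegularLocalRing (Localization.AtPrime (Ideal.comap (Subring.inclusion h) (IsLocalRing.maximalIdeal W'))) :=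
  Summit.ResolutionOfSingularities.ResolutionOfSingularities.Theorems.stub_transportSingular

/-- STUB 2c — NON-RULEDNESS ALONG THE SEMILINEAR RESIDUE ISOMORPHISM (true; M-sized).  With `W' = W.comap τ`, `τ`
restricts to `W' ≃+* W` mapping `𝔪_{W'}` onto `𝔪_W`, hence induces `θ : κ(W') ≃+* κ(W)` with
`θ (residue (c·1)) = residue ((ι c)·1)`.  A ruling `(L', t')` of `κ(W')` over `k` maps to the ruling
`(L'.map θ, θ t')` of `κ(W)`: the image of `k` lies in `L'.map θ` because `ι` is onto, transcendence and the
`f(t)/g(t)` presentation are preserved by `Polynomial.map`/`eval₂` along `θ`.  Contrapositive. [folklore] -/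
theorem stub_transportNonRuled : ∀ (k K : Type) [Field k] [Field K] [Algebra k K] (τ : K ≃+* K) (ι : k ≃+* k), (∀ c : k, τ (algebraMap k K c) = algebraMap k K (ι c)) → ∀ (W W' : ValuationSubring K), W' = W.comap (τ : K →+* K) → ∀ (hk : ∀ c : k, algebraMap k K c ∈ W) (hk' : ∀ c : k, algebraMap k K c ∈ W'), ¬ (∃ (L : Subfield (IsLocalRing.ResidueField W)) (t : IsLocalRing.ResidueField W), (∀ c : k, IsLocalRing.residue W ⟨algebraMap k K c, hk c⟩ ∈ L) ∧ (∀ f : Polynomial L, f ≠ 0 → Polynomial.eval₂ L.subtype t f ≠ 0) ∧ (∀ x : IsLocalRing.ResidueField W, ∃ f g : Polynomial L, Polynomial.eval₂ L.subtype t g ≠ 0 ∧ x * Polynomial.eval₂ L.subtype t g = Polynomial.eval₂ L.subtype t f)) → ¬ (∃ (L : Subfield (IsLocalRing.ResidueField W')) (t : IsLocalRing.ResidueField W'), (∀ c : k, IsLocalRing.residue W' ⟨algebraMap k K c, hk' c⟩ ∈ L) ∧ (∀ f : Polynomial L, f ≠ 0 → Polynomial.eval₂ L.subtype t f ≠ 0)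 ∧ (∀ x : IsLocalRing.ResidueField W', ∃ f g : Polynomial L, Polynomial.eval₂ L.subtype t g ≠ 0 ∧ x * Polynomial.eval₂ L.subtype t g = Polynomial.eval₂ L.subtype t f)) :=
  Summit.ResolutionOfSingularities.ResolutionOfSingularities.Theorems.stub_transportNonRuled

/-- STUB 3 — ENGINE (A): CONTRACTION KILLS PERIODICITY (true; M-sized; verbatim from the registered skeleton).
`S ⊆ K` a subring, `P ≠ 0` an ideal, `τ` a ring automorphism of `K` with `τ S ⊆ S` and `τ P ⊆ P²`; then for every
DISCRETE valuation ring `W ⊇ S` of `K` with `P ⊆ 𝔪_W` the orbit `n ↦ W.comap τⁿ` is injective.  Proof: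
`W.comap τᵐ = W.comap τⁿ` (`m < n`) gives `W = W.comap τᵈ`, `d = n − m ≥ 1`; then `τᵈ` restricts to a ring
AUTOmorphism of `W`, hence preserves its normalised valuation `v`; but `τᵈ P ⊆ P²`, so for `r ∈ P ∖ 0` of minimal
value `m₀ ≥ 1`, `m₀ = v(τᵈ r) ≥ 2 m₀` — contradiction. [folklore] -/
theorem stub_contractingInjective : ∀ (K : Type) [Field K] (S : Subring K) (P : Ideal S), P ≠ ⊥ → ∀ (τ : K ≃+* K), (∀ r : K, r ∈ S → τ r ∈ S) → (∀ r : S, r ∈ P → ∃ r' : S, r' ∈ P ^ 2 ∧ (r' : K) = τ (r : K)) → ∀ W : ValuationSubring K, IsDiscreteValuationRing W → S ≤ W.toSubring → (∀ r : S, r ∈ P → (r : K) ∈ W.nonunits) → Function.Injective (fun n : ℕ => W.comap ((τ ^ n : K ≃+* K) : K →+* K)) :=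
  Summit.ResolutionOfSingularities.ResolutionOfSingularities.Theorems.stub_contractingInjective

/-- STUB 4 — ENGINE (B): A TRANSCENDENTAL MODULUS KILLS PERIODICITY (true; proved sorry-free by the strategist,
`Lines/automorphism_orbit_modulusInjective.lean`; verbatim from the registered skeleton).  `τ` semilinear over `ι`,
`k ⊆ W`, `τ x = x`, `a ∈ k` with `ιⁿ a ≠ a` for `n ≥ 1`, and `x − a·1 ∈ 𝔪_W`.  Then `n ↦ W.comap τⁿ` is injective.
[folklore] -/
theorem stub_modulusInjective : ∀ (k K : Type) [Field k] [Field K] [Algebra k K] (τ : K ≃+* K) (ι : k ≃+* k), (∀ c : k, τ (algebraMap k K c) = algebraMap k K (ι c)) → ∀ W : ValuationSubring K, (∀ c : k, algebraMap k K c ∈ W) → ∀ (x : K) (a : k), τ x = x → (∀ n : ℕ, 0 < n → (ι ^ n) a ≠ a) → x - algebraMap k K a ∈ W.nonunits → Function.Injective (fun n : ℕ => W.comap ((τ ^ n : K ≃+* K) : K →+* K)) :=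
  Summit.ResolutionOfSingularities.ResolutionOfSingularities.Theorems.stub_modulusInjective

/-! ## Composition (kernel-checked; no `sorry` below this line) -/

/-- The orbit line concludes the crux BY NAME from the six registered stubs: the orbit `n ↦ W.comap τⁿ` of the germ's
place is injective by its certificate (`stub_contractingInjective` or `stub_modulusInjective`) and stays inside the
witness set by induction on `n` (`stub_transportPlace` + `stub_transportSingular` + `stub_transportNonRuled`, using
`W.comap τⁿ⁺¹ = (W.comap τⁿ).comap τ`), so the witness set of the germ's affine model is infinite
(`Set.infinite_of_injective_forall_mem`). -/
theorem NonRuledDivisors_of : NonRuledDivisors := by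
  obtain ⟨p, hp, k, K, instk, instc, instK, instA, R, hRfg, hfrac, P, instP, hsing, τ, ι, hsemi, hR, hP,
    W, hdom, hW, hcert⟩ := stub_orbitGerm
  -- the orbit
  let f : ℕ → ValuationSubring K := fun n => W.comap ((τ ^ n : K ≃+* K) : K →+* K)
  have hf0 : f 0 = W := by
    ext y
    simp [f, ValuationSubring.mem_comap]
  have hfsucc : ∀ n : ℕ, f (n + 1) = (f n).comap (τ : K →+* K) := by
    intro n
    ext y
    simp only [f, ValuationSubring.mem_comap]
    rfl
  -- injectivity of the orbit from the certificate
  have hinj : Function.Injective f := by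
    rcases hcert with ⟨hPne, hcon⟩ | ⟨x, a, hx, ha, hxa⟩
    · obtain ⟨hk, hdvr, hft, ⟨hle, _⟩, hnr⟩ := hW
      exact stub_contractingInjective K R.toSubring P hPne τ hR hcon W hdvr hle hdom
    · obtain ⟨hk, _⟩ := hW
      exact stub_modulusInjective k K τ ι hsemi W hk x a hx ha hxa
  -- every member of the orbit is in the witness set (and dominates `P`)
  have hall : ∀ n : ℕ, (∃ hk : (∀ c : k, algebraMap k K c ∈ (f n)), IsDiscreteValuationRing (f n) ∧ (∃ B : Subalgebra k K, B.FG ∧ B.toSubring ≤ (f n).toSubring ∧ ∀ x : K, x ∈ (f n) → ∃ b s : K, b ∈ B ∧ s ∈ B ∧ s ∉ (f n).nonunits ∧ x * s = b) ∧ (∃ h : R.toSubring ≤ (f n).toSubring, ¬ IsRegularLocalRing (Localization.AtPrime (Ideal.comap (Subring.inclusion h) (IsLocalRing.maximalIdeal (f n))))) ∧ ¬ (∃ (L : Subfield (IsLocalRing.ResidueField (f n))) (t : IsLocalRing.ResidueField (f n)), (∀ c : k, IsLocalRing.residue (f n) ⟨algebraMap k K c, hk c⟩ ∈ L) ∧ (∀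 f : Polynomial L, f ≠ 0 → Polynomial.eval₂ L.subtype t f ≠ 0) ∧ (∀ x : IsLocalRing.ResidueField (f n), ∃ f g : Polynomial L, Polynomial.eval₂ L.subtype t g ≠ 0 ∧ x * Polynomial.eval₂ L.subtype t g = Polynomial.eval₂ L.subtype t f))) ∧ (∀ r : R.toSubring, r ∈ P → (r : K) ∈ (f n).nonunits) := by
    intro n
    induction n with
    | zero =>
      rw [hf0]
      exact ⟨hW, hdom⟩
    | succ n ih =>
      obtain ⟨⟨hk, hdvr, hft, ⟨hle, _⟩, hnr⟩, hdomn⟩ := ih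
      obtain ⟨hk', hdvr', hft', hle', hdom'⟩ :=
        stub_transportPlace k K R P τ ι hsemi hR hP (f n) (f (n + 1)) (hfsucc n) hk hdvr hft hle hdomn
      have hsing' := stub_transportSingular K R.toSubring P hsing (f (n + 1)) hle' hdom'
      have hnr' := stub_transportNonRuled k K τ ι hsemi (f n) (f (n + 1)) (hfsucc n) hk hk' hnr
      exact ⟨⟨hk', hdvr', hft', ⟨hle', hsing'⟩, hnr'⟩, hdom'⟩
  refine ⟨p, hp, k, K, instk, instc, instK, instA, R, hRfg, hfrac, ?_⟩
  exact Set.infinite_of_injective_forall_mem hinj (fun n => (hall n).1)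

end Summit.ResolutionOfSingularities.ResolutionOfSingularities.Cruxes.NonRuledDivisors.AutomorphismOrbit
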